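import Mathlib
import HarnessLib

/-!
# Far field of the potential-flow witness `Φ(z) = 1/2 - (N(c + w) - N(c)) w⁻¹ / N'(c)`

Stub `stub_farField` of the line `potential-flow-essential-singularity` for the crux
`MarginalStabilityChain.StretchedVortexRows` (`stmt-AnomalousDissipation-3009`).

With `k = 2π/L > 0` and `w = exp(-ik(x + iy)) = e^{ky} e^{-ikx}` (so that `exp(+ik(x + iy)) = w⁻¹`),
the registered function is `y ↦ 1/2 - (N(c + w) - N(c)) · w⁻¹ / N'(c)` for a fixed `x`.

* As `y → -∞`: `‖w‖ = e^{ky} → 0` and `w ≠ 0`, so `w → 0` in the punctured neighbourhood filter;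
  the difference quotient `(N(c + w) - N(c)) w⁻¹ → N'(c)` (`HasDerivAt.tendsto_slope_zero`), hence
  the function tends to `1/2 - N'(c)/N'(c) = -1/2`.
* As `y → +∞`: `w = e^{ky} · exp(iθ)` with `θ = -kx` runs out along a fixed ray from `c`, on which
  `‖N(c + w)‖ ≤ K` eventually (hypothesis `hray`), so
  `‖(N(c + w) - N(c)) w⁻¹ / N'(c)‖ ≤ (K + ‖N(c)‖)/‖N'(c)‖ · e^{-ky} → 0`
  and the function tends to `1/2`.

Everything is generic in the entire function `N`; only Mathlib is used. [folklore]
-/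

set_option linter.dupNamespace false

noncomputable section

open scoped Topology ENNReal Real
open Filter Set Function MeasureTheory Complex

namespace Summit.AnomalousDissipation.AnomalousDissipation.Theorems
namespace MarginalStabilityChainStretchedVortexRows
namespace PotentialFlow

/-- The exponent `-ik(x + iy)` in Cartesian form: `-(k (x + iy) i) = ky + (-kx) i`. [folklore] -/
theorem farField_exponent_eq (k x y : ℝ) :
    -((k : ℂ) * ((x : ℂ) + (y : ℂ) * I) * I) = ((k * y : ℝ) : ℂ) + ((-(k * x) : ℝ) : ℂ) * I := by
  push_cast
  linear_combination (-((k : ℂ) * (y : ℂ))) * I_sq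

/-- Polar form of `w = exp(-ik(x + iy)) = e^{ky} · exp(i(-kx))`. [folklore] -/
theorem farField_w_polar (k x y : ℝ) :
    Complex.exp (-((k : ℂ) * ((x : ℂ) + (y : ℂ) * I) * I)) =
      ((Real.exp (k * y) : ℝ) : ℂ) * Complex.exp (((-(k * x) : ℝ) : ℂ) * I) := by
  rw [farField_exponent_eq, Complex.exp_add, ← Complex.ofReal_exp]

/-- `‖exp(-ik(x + iy))‖ = e^{ky}`. [folklore] -/
theorem farField_norm_w (k x y : ℝ) :
    ‖Complex.exp (-((k : ℂ) * ((x : ℂ) + (y : ℂ) * I) * I))‖ = Real.exp (k * y) := by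
  rw [farField_exponent_eq, Complex.norm_exp]
  congr 1
  simp

/-- `‖exp(+ik(x + iy))‖ = e^{-ky}`. [folklore] -/
theorem farField_norm_winv (k x y : ℝ) :
    ‖Complex.exp ((k : ℂ) * ((x : ℂ) + (y : ℂ) * I) * I)‖ = Real.exp (-(k * y)) := by
  rw [← neg_neg ((k : ℂ) * ((x : ℂ) + (y : ℂ) * I) * I), farField_exponent_eq, Complex.norm_exp]
  congr 1
  simp

/-- `exp(+ik(x + iy)) = (exp(-ik(x + iy)))⁻¹`. [folklore] -/
theorem farField_winv_eq (k x y : ℝ) :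
    Complex.exp ((k : ℂ) * ((x : ℂ) + (y : ℂ) * I) * I) =
      (Complex.exp (-((k : ℂ) * ((x : ℂ) + (y : ℂ) * I) * I)))⁻¹ := by
  rw [Complex.exp_neg, inv_inv]

/-- The normalised difference quotient `(N(c + w) - N(c)) w⁻¹ / N'(c) → 1` as `w → 0`, `w ≠ 0`,
for a differentiable `N` with `N'(c) ≠ 0`. [folklore] -/
theorem farField_slope_tendsto (N : ℂ → ℂ) (hN : Differentiable ℂ N) (c : ℂ) (hκ : deriv N c ≠ 0) :
    Tendsto (fun w : ℂ => (N (c + w) - N c) * w⁻¹ / deriv N c) (𝓝[≠] 0) (𝓝 1) := by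
  have h := ((hN c).hasDerivAt.tendsto_slope_zero).div_const (deriv N c)
  rw [div_self hκ] at h
  refine Tendsto.congr (fun w => ?_) h
  simp only [smul_eq_mul, mul_comm]

/-- For `k > 0` and fixed `x`, `w(y) = exp(-ik(x + iy)) → 0` within `{0}ᶜ` as `y → -∞`.
[folklore] -/
theorem farField_w_tendsto_atBot (k x : ℝ) (hk : 0 < k) :
    Tendsto (fun y : ℝ => Complex.exp (-((k : ℂ) * ((x : ℂ) + (y : ℂ) * I) * I))) atBot
      (𝓝[≠] 0) := by
  refine tendsto_nhdsWithin_iff.2 ⟨?_, Eventually.of_forall fun y =>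
    mem_compl_singleton_iff.2 (Complex.exp_ne_zero _)⟩
  rw [tendsto_zero_iff_norm_tendsto_zero]
  simp only [farField_norm_w]
  exact Real.tendsto_exp_atBot.comp (tendsto_id.const_mul_atBot hk)

/-- The far field at `y → -∞`: `1/2 - (N(c + w) - N(c)) w⁻¹ / N'(c) → -1/2`. [folklore] -/
theorem farField_tendsto_atBot (N : ℂ → ℂ) (hN : Differentiable ℂ N) (c : ℂ) (hκ : deriv N c ≠ 0)
    (k : ℝ) (hk : 0 < k) (x : ℝ) :
    Tendsto (fun y : ℝ => (1 / 2 : ℂ) -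
        (N (c + Complex.exp (-((k : ℂ) * ((x : ℂ) + (y : ℂ) * I) * I))) - N c) *
          Complex.exp ((k : ℂ) * ((x : ℂ) + (y : ℂ) * I) * I) / deriv N c)
      atBot (𝓝 (-(1 / 2))) := by
  have h1 := (farField_slope_tendsto N hN c hκ).comp (farField_w_tendsto_atBot k x hk)
  have h2 := (tendsto_const_nhds (x := (1 / 2 : ℂ))).sub h1
  have h3 : (1 / 2 : ℂ) - 1 = -(1 / 2) := by norm_num
  rw [h3] at h2
  refine Tendsto.congr (fun y => ?_) h2
  simp only [Function.comp_def]
  rw [farField_winv_eq]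

/-- The far field at `y → +∞`: along the ray of angle `-kx` from `c` the entire function is
eventually bounded by `K`, so `1/2 - (N(c + w) - N(c)) w⁻¹ / N'(c) → 1/2`. [folklore] -/
theorem farField_tendsto_atTop (N : ℂ → ℂ) (c : ℂ) (hκ : deriv N c ≠ 0) (K : ℝ)
    (hray : ∀ θ : ℝ, ∃ R₀ : ℝ, ∀ R : ℝ, R₀ ≤ R → ‖N (c + R * Complex.exp (θ * I))‖ ≤ K)
    (k : ℝ) (hk : 0 < k) (x : ℝ) :
    Tendsto (fun y : ℝ => (1 / 2 : ℂ) -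
        (N (c + Complex.exp (-((k : ℂ) * ((x : ℂ) + (y : ℂ) * I) * I))) - N c) *
          Complex.exp ((k : ℂ) * ((x : ℂ) + (y : ℂ) * I) * I) / deriv N c)
      atTop (𝓝 (1 / 2)) := by
  obtain ⟨R₀, hR₀⟩ := hray (-(k * x))
  have hκpos : 0 < ‖deriv N c‖ := norm_pos_iff.2 hκ
  have hev : ∀ᶠ y : ℝ in atTop, R₀ ≤ Real.exp (k * y) :=
    (Real.tendsto_exp_atTop.comp (tendsto_id.const_mul_atTop hk)).eventually_ge_atTop R₀
  have hbound : ∀ᶠ y : ℝ in atTop,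
      ‖(N (c + Complex.exp (-((k : ℂ) * ((x : ℂ) + (y : ℂ) * I) * I))) - N c) *
          Complex.exp ((k : ℂ) * ((x : ℂ) + (y : ℂ) * I) * I) / deriv N c‖ ≤
        (K + ‖N c‖) / ‖deriv N c‖ * Real.exp (-(k * y)) := by
    filter_upwards [hev] with y hy
    have hNw : ‖N (c + Complex.exp (-((k : ℂ) * ((x : ℂ) + (y : ℂ) * I) * I)))‖ ≤ K := by
      rw [farField_w_polar]
      exact hR₀ (Real.exp (k * y)) hy
    have hdiff : ‖N (c + Complex.exp (-((k : ℂ) * ((x : ℂ) + (y : ℂ) * I) * I))) - N c‖ ≤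
        K + ‖N c‖ :=
      (norm_sub_le _ _).trans (by linarith)
    rw [norm_div, norm_mul, farField_norm_winv, div_mul_eq_mul_div]
    exact div_le_div_of_nonneg_right
      (mul_le_mul_of_nonneg_right hdiff (Real.exp_pos _).le) hκpos.le
  have hlim : Tendsto (fun y : ℝ => (K + ‖N c‖) / ‖deriv N c‖ * Real.exp (-(k * y))) atTop
      (𝓝 0) := by
    have h := (Real.tendsto_exp_neg_atTop_nhds_zero.comp (tendsto_id.const_mul_atTop hk)).const_mul
      ((K + ‖N c‖) / ‖deriv N c‖)
    rw [mul_zero] at h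
    exact h
  have h0 := squeeze_zero_norm' hbound hlim
  have h := (tendsto_const_nhds (x := (1 / 2 : ℂ))).sub h0
  rw [sub_zero] at h
  exact h

/-- **Stub 6.** Far field of `Φ(z) = 1/2 - (N(c + w) - N(c)) w⁻¹ / N'(c)`, `w = e^{-ikz}`,
`k = 2π/L`: for fixed `x`, `w = e^{ky} e^{-ikx}` runs OUT along the ray of angle `-kx` as `y → +∞`
(there `N(c + w)` is eventually bounded by `K`, so `Φ → 1/2`) and IN to `0` as `y → -∞`
(difference quotient `→ N'(c)`, so `Φ → 1/2 - 1`). [folklore] -/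
theorem stub_farField (N : ℂ → ℂ) (hN : Differentiable ℂ N) (c : ℂ) (hκ : deriv N c ≠ 0) (K : ℝ)
    (hray : ∀ θ : ℝ, ∃ R₀ : ℝ, ∀ R : ℝ, R₀ ≤ R → ‖N (c + R * Complex.exp (θ * I))‖ ≤ K)
    (L : ℝ) (hL : 0 < L) :
    (∀ x : ℝ, Tendsto (fun y : ℝ => (1 / 2 : ℂ) -
        (N (c + Complex.exp (-(((2 * π / L : ℝ) : ℂ) * ((x : ℂ) + (y : ℂ) * I) * I))) - N c) *
          Complex.exp (((2 * π / L : ℝ) : ℂ) * ((x : ℂ) + (y : ℂ) * I) * I) / deriv N c)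
        atTop (𝓝 (1 / 2))) ∧
    (∀ x : ℝ, Tendsto (fun y : ℝ => (1 / 2 : ℂ) -
        (N (c + Complex.exp (-(((2 * π / L : ℝ) : ℂ) * ((x : ℂ) + (y : ℂ) * I) * I))) - N c) *
          Complex.exp (((2 * π / L : ℝ) : ℂ) * ((x : ℂ) + (y : ℂ) * I) * I) / deriv N c)
        atBot (𝓝 (-(1 / 2)))) := by
  have hk : 0 < 2 * π / L := div_pos (mul_pos two_pos Real.pi_pos) hL
  exact ⟨fun x => farField_tendsto_atTop N c hκ K hray (2 * π / L) hk x,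
    fun x => farField_tendsto_atBot N hN c hκ (2 * π / L) hk x⟩

end PotentialFlow
end MarginalStabilityChainStretchedVortexRows
end Summit.AnomalousDissipation.AnomalousDissipation.Theorems
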